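import Summits.BirchSwinnertonDyer.Rank1Residual.X1.AdicCompletionIntegerHom
import Summits.BirchSwinnertonDyer.Rank1Residual.X1.InertiaTransport
import Literature.NumberTheory.GaloisRepresentations.LocalGaloisGroupHenselProofs
import Literature.NumberTheory.GaloisRepresentations.ClosureValuation
import HarnessLib

/-!
# LP-B completed: an isomorphism of algebraic closures over `K_v → L_w` rescales the spectral
# norm by a positive power, hence carries absolute integers to absolute integers and INERTIA TO
# INERTIA, both ways (cell `b2b-bsdres`, unit `b2b-bsdres-eisenstein-p1`, gen 20; X1R0-GAPMAP
# §28.4 (LP-B), §29; memo `V76-LOCAL-TERM-PLAN.md` §5.3–5.6)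

HONEST FRAMING (run/shared/lean/b2b/bsd-rank1-residual/, verbatim in every file): the goal of the
cell is to DELETE the COMBINATION-SHAPED residual classes of the Birch–Swinnerton-Dyer formula for
ALL analytic-rank `≤ 1` elliptic curves over `ℚ` — "full BSD formula for every rank `≤ 1` curve in
class `C`" assembled STRICTLY from published theorems — so that the rank-`≤ 1` remainder becomes
exactly the CONSTRUCTION-SHAPED classes, which are TYPED (missing-input `Prop`s), NOT attempted.
This is not "finishing BSD". Sub-cell `b2b-bsdres-eisenstein-p1`: research route; NO CLAIM BEYOND
STATED CLASSES; nothing here changes a label; nothing is booked. THEOREMS ONLY — no definition, no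
named fact; pure local-field / valuation / Galois plumbing, nothing about any curve.

## What and why

The local package at the prime `wp` of `ℚ_n` above `p` (what is left of route M's local term after
`X1/GeneratorCountLayerAtPStrict`) needs the INERTIA BRIDGE: n1011's transport
`θ = ι₂ (·) ι₂⁻¹ : Γ_{K_v} ⊇ H_ι → Γ_{L_w}` (`Additive/LocalSubgroupTransport.transportAut`, for a
factorisation isomorphism `ι₂ : \bar K_v ≃+* \bar L_w` over the map of completions
`f = adicCompletionMap : K_v → L_w`) must carry `absInertia K_v` into (in fact onto its image in)
`absInertia L_w`. `X1/InertiaTransport` proved the shell modulo the arithmetic input (b)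
"`ι₂⁻¹` preserves absolute integers"; `X1/AdicCompletionIntegerHom` proved
`‖f a‖_w = ‖a‖_v ^ c` (`c > 0`). This file finishes LP-B:

* §1 (general, `E → E'` complete non-archimedean normed fields)
  `spectralNorm_ringEquiv_eq_rpow`: if `‖f a‖ = ‖a‖ ^ c` then
  **`spectralNorm E' (ι₂ x) = (spectralNorm E x) ^ c`** for every `x ∈ Ē` — uniqueness of the
  spectral norm (Mathlib `spectralNorm_unique_field_norm_ext`) applied to the absolute value
  `x ↦ spectralNorm E' (ι₂ x) ^ {1/c}` of `Ē`, which extends `‖·‖_E`; multiplicativity of the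
  spectral norm over the complete field `E'` (Mathlib `spectralAlgNorm_mul`).
* §2 (`K_v`, `K` a number field): the tree's objects `absIntegers 𝒪[K_v] K_v`, `absMaximalIdeal K_v`,
  `absInertia K_v` (GalRep files, valuation ring `𝒪[K_v]` of the `ValuativeRel`) read off MATHLIB's
  norm of `K_v` and its spectral norm on `\bar K_v`: `≤ 1`, `< 1`, and
  `σ ∈ absInertia K_v ↔ ∀ b, sN b ≤ 1 → sN (σ • b − b) < 1` (the generic Hensel-file lemmas
  `mem_absIntegers_integer_iff_spectralNorm_le_one` / `mem_radical_map_maximalIdeal_iff` for the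
  valuation `ValuativeRel.valuation K_v`, whose unit ball is Mathlib's).
* §3 (`K ⊆ L`, `w ∣ v`, `ι₂` over `adicCompletionMap`): `exists_spectralNorm_ringEquiv_eq_rpow`;
  **`ringEquiv_mem_absIntegers_iff`** (`ι₂ x ∈ S_{L_w} ↔ x ∈ S_{K_v}` — (a) and (b) of the shell at
  once); **`transportAut_mem_absInertia_iff`**: `ι₂ h ι₂⁻¹ ∈ absInertia L_w ↔ h ∈ absInertia K_v`.

References: [NeukirchANT1999] Ch. II (4.8) (uniqueness of the extension of a complete valuation),
(9.3); [SerreLocalFields1979] Ch. II §2 Prop. 3, Cor. 2–3; [BGR] 3.2 (spectral norm, as in Mathlib).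
-/

noncomputable section

open scoped ValuativeRel NNReal Pointwise
open Field Literature.NumberTheory.GaloisRepresentations
  Literature.NumberTheory.GaloisRepresentations.IsNonarchimedeanLocalField
  Summit.BirchSwinnertonDyer.Rank1Residual.Additive.LocalTransport

universe u

namespace Summit.BirchSwinnertonDyer.Rank1Residual.X1.SpectralNormTransport

/-! ## §1. Transport of the spectral norm along an isomorphism of algebraic closures -/

section General

variable {E : Type u} [NontriviallyNormedField E] [CompleteSpace E] [IsUltrametricDist E]
  {E' : Type u} [NontriviallyNormedField E'] [CompleteSpace E'] [IsUltrametricDist E']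
  (f : E →+* E') (ι₂ : AlgebraicClosure E ≃+* AlgebraicClosure E')
  (hι₂ : ∀ x : E, ι₂ (algebraMap E (AlgebraicClosure E) x) =
    algebraMap E' (AlgebraicClosure E') (f x))

include hι₂ in
/-- **Transport of spectral norms.** If `ι₂ : Ē ≃+* Ē'` lies over `f : E → E'` (complete
non-archimedean fields) and `‖f a‖ = ‖a‖ ^ c` with `c > 0`, then
`spectralNorm E' (ι₂ x) = (spectralNorm E x) ^ c` for all `x ∈ Ē`: the absolute value
`x ↦ spectralNorm E' (ι₂ x) ^ {1/c}` of `Ē` extends `‖·‖_E`, so it is the spectral norm.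
[cite: NeukirchANT1999, Ch. II (4.8)] -/
theorem spectralNorm_ringEquiv_eq_rpow {c : ℝ} (hc : 0 < c) (hfc : ∀ a : E, ‖f a‖ = ‖a‖ ^ c)
    (x : AlgebraicClosure E) :
    spectralNorm E' (AlgebraicClosure E') (ι₂ x) =
      spectralNorm E (AlgebraicClosure E) x ^ c := by
  let N : AlgebraicClosure E → ℝ := fun y ↦ spectralNorm E' (AlgebraicClosure E') (ι₂ y)
  have hN_nonneg : ∀ y, 0 ≤ N y := fun y ↦ spectralNorm_nonneg _
  have hN_mul : ∀ y z, N (y * z) = N y * N z := fun y z ↦ by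
    have h := spectralAlgNorm_mul (K := E') (L := AlgebraicClosure E') (ι₂ y) (ι₂ z)
    simp only [spectralAlgNorm_def] at h
    simp only [N, map_mul]
    exact h
  have hN_zero : ∀ y, N y = 0 ↔ y = 0 := fun y ↦
    ⟨fun h ↦ (map_eq_zero_iff ι₂ ι₂.injective).mp
        (eq_zero_of_map_spectralNorm_eq_zero h (Algebra.IsAlgebraic.isAlgebraic (ι₂ y))),
      fun h ↦ by simp only [N, h, map_zero, spectralNorm_zero]⟩
  have hN_na : ∀ y z, N (y + z) ≤ max (N y) (N z) := fun y z ↦ by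
    simp only [N, map_add]
    exact isNonarchimedean_spectralNorm _ _
  have hcinv : 0 < c⁻¹ := inv_pos.mpr hc
  let g : AbsoluteValue (AlgebraicClosure E) ℝ :=
    { toFun := fun y ↦ N y ^ c⁻¹
      map_mul' := fun y z ↦ by
        change N (y * z) ^ c⁻¹ = N y ^ c⁻¹ * N z ^ c⁻¹
        rw [hN_mul, Real.mul_rpow (hN_nonneg y) (hN_nonneg z)]
      nonneg' := fun y ↦ Real.rpow_nonneg (hN_nonneg y) _
      eq_zero' := fun y ↦ by
        change N y ^ c⁻¹ = 0 ↔ y = 0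
        rw [Real.rpow_eq_zero (hN_nonneg y) hcinv.ne', hN_zero]
      add_le' := fun y z ↦ by
        change N (y + z) ^ c⁻¹ ≤ N y ^ c⁻¹ + N z ^ c⁻¹
        have h1 : N (y + z) ^ c⁻¹ ≤ (max (N y) (N z)) ^ c⁻¹ :=
          Real.rpow_le_rpow (hN_nonneg _) (hN_na y z) hcinv.le
        refine h1.trans ?_
        rcases le_total (N y) (N z) with h | h
        · rw [max_eq_right h]
          exact le_add_of_nonneg_left (Real.rpow_nonneg (hN_nonneg y) _)
        · rw [max_eq_left h]
          exact le_add_of_nonneg_right (Real.rpow_nonneg (hN_nonneg z) _) }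
  have hg_ext : ∀ a : E, g (algebraMap E (AlgebraicClosure E) a) = ‖a‖ := fun a ↦ by
    change N (algebraMap E (AlgebraicClosure E) a) ^ c⁻¹ = ‖a‖
    simp only [N]
    rw [hι₂ a, spectralNorm_extends, hfc a, Real.rpow_rpow_inv (norm_nonneg a) hc.ne']
  have huniq : N x ^ c⁻¹ = spectralNorm E (AlgebraicClosure E) x :=
    spectralNorm_unique_field_norm_ext (K := E) (f := g) hg_ext x
  calc N x = (N x ^ c⁻¹) ^ c := (Real.rpow_inv_rpow (hN_nonneg x) hc.ne').symm
    _ = _ := by rw [huniq]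

end General

/-! ## §2. `absIntegers 𝒪[K_v] K_v`, `absMaximalIdeal K_v`, `absInertia K_v` via Mathlib's spectral norm -/

section AdicCompletion

open NumberField IsDedekindDomain

variable {K : Type u} [Field K] [NumberField K] (v : HeightOneSpectrum (𝓞 K))

/-- The valuation of the valuative relation of `K_v` and Mathlib's norm have the same closed unit
ball (`= 𝓞_v`). [folklore] -/
theorem valuation_le_one_iff_norm_le_one (x : v.adicCompletion K) :
    ValuativeRel.valuation (v.adicCompletion K) x ≤ 1 ↔ ‖x‖ ≤ 1 := by
  rw [AdicCompletionIntegerHom.valuation_le_one_iff, ← HeightOneSpectrum.mem_adicCompletionIntegers,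
    mem_adicCompletionIntegers_iff_norm_le_one]

/-- **`S_{K_v} = absIntegers 𝒪[K_v] K_v` is the closed unit ball of Mathlib's spectral norm on
`\bar K_v`.** [cite: SerreLocalFields1979, Ch. II §2 Prop. 3] -/
theorem mem_absIntegers_iff_spectralNorm_le_one (x : AlgebraicClosure (v.adicCompletion K)) :
    x ∈ absIntegers 𝒪[v.adicCompletion K] (v.adicCompletion K) ↔
      spectralNorm (v.adicCompletion K) (AlgebraicClosure (v.adicCompletion K)) x ≤ 1 :=
  letI := Valued.toNontriviallyNormedField (v.adicCompletion K) (WithZero (Multiplicative ℤ))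
  mem_absIntegers_integer_iff_spectralNorm_le_one
    (w := ValuativeRel.valuation (v.adicCompletion K)) (valuation_le_one_iff_norm_le_one v) x

/-- **`𝔓_{K_v} = absMaximalIdeal K_v` is the open unit ball of Mathlib's spectral norm.**
[cite: SerreLocalFields1979, Ch. II §2 Prop. 3 and Cor. 2] -/
theorem mem_absMaximalIdeal_iff_spectralNorm_lt_one
    (b : absIntegers 𝒪[v.adicCompletion K] (v.adicCompletion K)) :
    b ∈ absMaximalIdeal (v.adicCompletion K) ↔
      spectralNorm (v.adicCompletion K) (AlgebraicClosure (v.adicCompletion K)) b < 1 :=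
  letI := Valued.toNontriviallyNormedField (v.adicCompletion K) (WithZero (Multiplicative ℤ))
  mem_radical_map_maximalIdeal_iff
    (w := ValuativeRel.valuation (v.adicCompletion K)) (valuation_le_one_iff_norm_le_one v) b

/-- **Inertia criterion for `K_v` in Mathlib's spectral norm**: `σ ∈ absInertia K_v` iff
`sN (σ • b − b) < 1` for all `b ∈ \bar K_v` with `sN b ≤ 1`.
[cite: NeukirchANT1999, Ch. II (9.3) Definition] -/
theorem mem_absInertia_iff_spectralNorm {σ : absoluteGaloisGroup (v.adicCompletion K)} :
    σ ∈ absInertia (v.adicCompletion K) ↔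
      ∀ b : AlgebraicClosure (v.adicCompletion K),
        spectralNorm (v.adicCompletion K) (AlgebraicClosure (v.adicCompletion K)) b ≤ 1 →
        spectralNorm (v.adicCompletion K) (AlgebraicClosure (v.adicCompletion K)) (σ • b - b) < 1 := by
  rw [mem_absInertia_iff]
  constructor
  · intro h b hb
    have h1 := h ⟨b, (mem_absIntegers_iff_spectralNorm_le_one v b).mpr hb⟩
    rw [mem_absMaximalIdeal_iff_spectralNorm_lt_one] at h1
    exact h1
  · intro h b
    rw [mem_absMaximalIdeal_iff_spectralNorm_lt_one]
    exact h b ((mem_absIntegers_iff_spectralNorm_le_one v b).mp b.2)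

end AdicCompletion

/-! ## §3. The inertia bridge for `ι₂ : \bar K_v ≃+* \bar L_w` over `K_v → L_w` -/

section Bridge

open NumberField IsDedekindDomain Literature.NumberTheory.EllipticCurves

variable {K : Type u} [Field K] [NumberField K] (L : Type u) [Field L] [NumberField L] [Algebra K L]
  (v : HeightOneSpectrum (𝓞 K)) (w : HeightOneSpectrum (𝓞 L)) [w.asIdeal.LiesOver v.asIdeal]
  (ι₂ : AlgebraicClosure (v.adicCompletion K) ≃+* AlgebraicClosure (w.adicCompletion L))
  (hι₂ : ∀ x : v.adicCompletion K,
    ι₂ (algebraMap (v.adicCompletion K) (AlgebraicClosure (v.adicCompletion K)) x) =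
      algebraMap (w.adicCompletion L) (AlgebraicClosure (w.adicCompletion L))
        (adicCompletionMap (K := K) L v w x))

include hι₂

/-- **`spectralNorm L_w (ι₂ x) = (spectralNorm K_v x) ^ c` for some `c > 0`** (§1 with
`X1/AdicCompletionIntegerHom.exists_norm_adicCompletionMap_eq_rpow`).
[cite: NeukirchANT1999, Ch. II (4.8)] -/
theorem exists_spectralNorm_ringEquiv_eq_rpow :
    ∃ c : ℝ, 0 < c ∧ ∀ x : AlgebraicClosure (v.adicCompletion K),
      spectralNorm (w.adicCompletion L) (AlgebraicClosure (w.adicCompletion L)) (ι₂ x) =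
        spectralNorm (v.adicCompletion K) (AlgebraicClosure (v.adicCompletion K)) x ^ c := by
  letI := Valued.toNontriviallyNormedField (v.adicCompletion K) (WithZero (Multiplicative ℤ))
  letI := Valued.toNontriviallyNormedField (w.adicCompletion L) (WithZero (Multiplicative ℤ))
  obtain ⟨c, hc, hfc⟩ := AdicCompletionIntegerHom.exists_norm_adicCompletionMap_eq_rpow L v w
  exact ⟨c, hc, spectralNorm_ringEquiv_eq_rpow (adicCompletionMap (K := K) L v w) ι₂ hι₂ hc hfc⟩

/-- `spectralNorm L_w (ι₂ x) ≤ 1 ↔ spectralNorm K_v x ≤ 1`. [folklore] -/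
theorem spectralNorm_ringEquiv_le_one_iff (x : AlgebraicClosure (v.adicCompletion K)) :
    spectralNorm (w.adicCompletion L) (AlgebraicClosure (w.adicCompletion L)) (ι₂ x) ≤ 1 ↔
      spectralNorm (v.adicCompletion K) (AlgebraicClosure (v.adicCompletion K)) x ≤ 1 := by
  obtain ⟨c, hc, h⟩ := exists_spectralNorm_ringEquiv_eq_rpow L v w ι₂ hι₂
  rw [h x]
  refine ⟨fun h1 ↦ not_lt.mp fun h2 ↦ (Real.one_lt_rpow h2 hc).not_ge h1,
    fun h1 ↦ Real.rpow_le_one (spectralNorm_nonneg _) h1 hc.le⟩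

/-- `spectralNorm L_w (ι₂ x) < 1 ↔ spectralNorm K_v x < 1`. [folklore] -/
theorem spectralNorm_ringEquiv_lt_one_iff (x : AlgebraicClosure (v.adicCompletion K)) :
    spectralNorm (w.adicCompletion L) (AlgebraicClosure (w.adicCompletion L)) (ι₂ x) < 1 ↔
      spectralNorm (v.adicCompletion K) (AlgebraicClosure (v.adicCompletion K)) x < 1 := by
  obtain ⟨c, hc, h⟩ := exists_spectralNorm_ringEquiv_eq_rpow L v w ι₂ hι₂
  rw [h x]
  refine ⟨fun h1 ↦ not_le.mp fun h2 ↦ (Real.one_le_rpow h2 hc.le).not_gt h1,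
    fun h1 ↦ Real.rpow_lt_one (spectralNorm_nonneg _) h1 hc⟩

/-- **`ι₂` identifies the absolute integers: `ι₂ x ∈ S_{L_w} ↔ x ∈ S_{K_v}`** — items (a) AND (b)
of the inertia-bridge shell `X1/InertiaTransport` at once. [cite: NeukirchANT1999, Ch. II (4.8)]
[cite: SerreLocalFields1979, Ch. II §2 Prop. 3] -/
theorem ringEquiv_mem_absIntegers_iff (x : AlgebraicClosure (v.adicCompletion K)) :
    ι₂ x ∈ absIntegers 𝒪[w.adicCompletion L] (w.adicCompletion L) ↔
      x ∈ absIntegers 𝒪[v.adicCompletion K] (v.adicCompletion K) := by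
  rw [mem_absIntegers_iff_spectralNorm_le_one, mem_absIntegers_iff_spectralNorm_le_one,
    spectralNorm_ringEquiv_le_one_iff L v w ι₂ hι₂]

/-- The arithmetic input (b) of `X1/InertiaTransport.transportAut_mem_absInertia`, DISCHARGED for
completions of number fields: `ι₂⁻¹` maps `S_{L_w}` into `S_{K_v}`. [cite: NeukirchANT1999, Ch. II (4.8)] -/
theorem ringEquiv_symm_mem_absIntegers (y : AlgebraicClosure (w.adicCompletion L))
    (hy : y ∈ absIntegers 𝒪[w.adicCompletion L] (w.adicCompletion L)) :
    ι₂.symm y ∈ absIntegers 𝒪[v.adicCompletion K] (v.adicCompletion K) := by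
  rw [← ringEquiv_mem_absIntegers_iff L v w ι₂ hι₂, RingEquiv.apply_symm_apply]
  exact hy

/-- **THE INERTIA BRIDGE (LP-B).** For `h ∈ Γ_{K_v}` fixing `ι₂⁻¹(L_w)` pointwise, the transported
automorphism `ι₂ h ι₂⁻¹ ∈ Γ_{L_w}` (`transportAut`) lies in `absInertia L_w` iff `h ∈ absInertia K_v`:
both inertia groups are `{σ | sN (σ b − b) < 1 whenever sN b ≤ 1}` and `ι₂` rescales the spectral
norm by a positive power. [cite: NeukirchANT1999, Ch. II (4.8), (9.3)]
[cite: SerreLocalFields1979, Ch. II §2 Cor. 3 to Prop. 3] [cite: SerreGaloisCohomology1997, II.§1.1] -/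
theorem transportAut_mem_absInertia_iff (h : absoluteGaloisGroup (v.adicCompletion K))
    (hh : ∀ y : w.adicCompletion L,
      (show AlgebraicClosure (v.adicCompletion K) ≃ₐ[v.adicCompletion K]
          AlgebraicClosure (v.adicCompletion K) from h)
        (ι₂.symm (algebraMap (w.adicCompletion L) (AlgebraicClosure (w.adicCompletion L)) y)) =
        ι₂.symm (algebraMap (w.adicCompletion L) (AlgebraicClosure (w.adicCompletion L)) y)) :
    transportAut ι₂ h hh ∈ absInertia (w.adicCompletion L) ↔ h ∈ absInertia (v.adicCompletion K) := by
  have key : ∀ b : AlgebraicClosure (v.adicCompletion K),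
      transportAut ι₂ h hh • ι₂ b - ι₂ b = ι₂ (h • b - b) := fun b ↦ by
    rw [map_sub]
    change (show AlgebraicClosure (w.adicCompletion L) ≃ₐ[w.adicCompletion L]
        AlgebraicClosure (w.adicCompletion L) from transportAut ι₂ h hh) (ι₂ b) - ι₂ b =
      ι₂ ((show AlgebraicClosure (v.adicCompletion K) ≃ₐ[v.adicCompletion K]
        AlgebraicClosure (v.adicCompletion K) from h) b) - ι₂ b
    rw [transportAut_apply, RingEquiv.symm_apply_apply]
  rw [mem_absInertia_iff_spectralNorm, mem_absInertia_iff_spectralNorm]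
  constructor
  · intro H b hb
    have h1 := H (ι₂ b) ((spectralNorm_ringEquiv_le_one_iff L v w ι₂ hι₂ b).mpr hb)
    rwa [key, spectralNorm_ringEquiv_lt_one_iff L v w ι₂ hι₂] at h1
  · intro H y hy
    obtain ⟨b, rfl⟩ := ι₂.surjective y
    rw [key, spectralNorm_ringEquiv_lt_one_iff L v w ι₂ hι₂]
    exact H b ((spectralNorm_ringEquiv_le_one_iff L v w ι₂ hι₂ b).mp hy)

end Bridge

end Summit.BirchSwinnertonDyer.Rank1Residual.X1.SpectralNormTransport

end
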